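import Summits.QuantumFields.BalabanUV.Beta.GAN24.DirichletVertexEnergy
import Summits.QuantumFields.BalabanUV.Beta.GAN24.DirichletBoxTwoLevelCore

/-!
# `BalabanUV.Beta.GAN24.DirichletVertexRefine` — binder row G-an2-4 / (CONV-C), road P2 PART IV, leaf L14 (the torus transfer), FILE C5a:
# THE CHART UNDER REFINEMENT — `par ∘ emb_{RN} = emb_N ∘ ⌊·/R⌋`, the ring index under `⌊·/R⌋`, the FINE WEIGHT `w′` of the socket and its
# comparison with the coarse weight `ω_V` (unit b2b-balaban-gan24-p2, gen 26, v1)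

HONEST FRAMING (cell contract, verbatim): «discharging `BetaPertH` makes Bałaban's UV stability UNCONDITIONAL — a real constructive-QFT
result; it is NOT the continuum limit and NOT the Clay problem.»  SUPPLIER module under the T⁴-DAG sub-row `T4-U1a.S-NE2-D1-DIRICHLET°`
(owner wording R24 «the full rate L⁻¹ beyond boxes OPEN»).  The weighted socket `DirichletBoxWeightedSockets.injected_le_of_weighted`
(p234489) couples the coarse weight `ω` on `Tor (fine N M)` and the fine weight `w′` on `Tor (fine (R·N) M)` through
`hcomp : ω y ≤ w′ x` for every fine site `x` of the `μ`-window of the coarse face at `y` (whose block parent is `y` or `y + e_μ`).  With the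
coarse weight `ω_V` of `DirichletVertexEnergy` (p244737) we DEFINE `w′(x) := ω_V(par x) + ω_V(par x − e₀) + ω_V(par x − e₁)`, so that `hcomp`
holds by construction (§3), and we show that near a re-entrant vertex `w′` is dominated by the fine distance weight: for
`x = emb_{RN} σ b i′ j′`, `w′(x) ≤ 3·(ρ(i′,j′) + 2R)/(R·N)` (§2) — the input the fine-level binder (A′) needs on the dyadic neighbourhoods.

## Contents ([folklore]; 0 sorry)
* §1 `crd_div`, **`par_emb : par (emb_{RN} σ b i′ j′) = emb_N σ b ⌊i′/R⌋ ⌊j′/R⌋`**, `tIdx_div_le`, `rho_div_le` (`R·ρ(⌊i′/R⌋,⌊j′/R⌋) ≤ ρ(i′,j′) + R`),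
  `tIdx_div_le_of` (window membership under `⌊·/R⌋`), `emb_sub_unitVec_fst/snd`, `rho_step`.
* §2 `omegaV_emb_le : (σ,b) ∈ V → (i,j) ∈ Q_K → ω_V K (emb σ b i j) ≤ ρ(i,j)/N`; the fine weight `wfine`; **`wfine_emb_le`**.
* §3 **`wfine_hcomp`**: the socket's comparison hypothesis for `(ω_V, wfine)`; `wfine_nonneg`, `wfine_le_three`.

ABSOLUTE RULE (cell, verbatim): «No internally-minted statement may enter as a cited fact. Every hypothesis is either kernel-proved in
this package or a verbatim quotation of a PUBLISHED theorem with page reference. The manuscript(s) under audit are NOT citable for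
their own disputed steps — they are the thing under adjudication; programme-internal (2001/route/tribunal) claims are never citable.»
Nothing printed is a hypothesis.  NOT CLAIMED: (A′), (Φ)/(Φ′), the END; NOT NE2, (CONV-C), `BetaPertH`, continuum, Clay.  «not in print;
our proof attempt».  HONEST DEPENDENCY: continuum YM on T⁴ ⇐ BetaPertH ∧ nine spine estimates (0/9 proved); BetaPertH ⇐ (D1) ∧ (D4) ∧
CAP+tail; G-an2-4 gates asym, D1 and NE2/3/4.
-/

noncomputable section

open scoped BigOperators ComplexConjugate Matrix
open Finset

namespace Summit.QuantumFields.BalabanUV.Beta.GAN24.DirichletVertexRefine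

open Literature.MathematicalPhysics.QuantumFieldTheory.Balaban1983to89.B5Prop11Plancherel (Tor fine unitVec)
open Literature.MathematicalPhysics.QuantumFieldTheory.Balaban1983to89.B5Block118 (tstep)
open Summit.QuantumFields.BalabanUV.T4Continuum.BalabanAveragedTowerModes (par val_par)
open Summit.QuantumFields.BalabanUV.Beta.GAN24.DirichletBoxTwoLevelCore (site par_site_lt par_site_ge)
open DirichletRingCutoff (tIdx one_le_tIdx)
open DirichletRingHessianWindow (rho tIdx_step)
open DirichletVertexChart
open DirichletVertexEnergy (invW omegaV invW_nonneg omegaV_pos omegaV_le_one inv_omegaV one_le_rho)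

variable (N R : ℕ) [NeZero N] [NeZero R] (M : Fin 2 → ℕ) [hM : ∀ μ, NeZero (M μ)]

/-! ## §1 The chart under refinement -/

omit [NeZero N] hM in
/-- the affine coordinate commutes with floor division by `R > 0`: `crd σ ν ⌊c/R⌋ = ⌊crd σ ν c / R⌋`. [folklore] -/
theorem crd_div (σ : Fin 2 → Bool) (ν : Fin 2) (c : ℤ) : crd σ ν (c / (R : ℤ)) = crd σ ν c / (R : ℤ) := by
  have hR : (0 : ℤ) < R := by exact_mod_cast Nat.pos_of_ne_zero (NeZero.ne R)
  unfold crd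
  split_ifs
  · rfl
  · -- `−1 − ⌊c/R⌋ = ⌊(−1 − c)/R⌋`
    have hr0 := Int.emod_nonneg c hR.ne'
    have hr1 := Int.emod_lt_of_pos c hR
    have hc : c % R = c - R * (c / R) := Int.emod_def c R
    have e : -1 - c = ((R : ℤ) - 1 - c % R) + R * (-1 - c / R) := by linarith [hc]
    have hz : ((R : ℤ) - 1 - c % R) / R = 0 := Int.ediv_eq_zero_of_lt (by omega) (by omega)
    rw [e, Int.add_mul_ediv_left _ _ hR.ne', hz, zero_add]

/-- the value of a chart coordinate at the fine level, as an integer modulo the fine period. [folklore] -/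
theorem val_emb_int (σ : Fin 2 → Bool) (b : Tor M) (i' j' : ℤ) (ν : Fin 2) :
    ∃ k : ℤ, (((emb (R * N) M σ b i' j' ν).val : ℕ) : ℤ)
      = ((R * N : ℕ) : ℤ) * ((b ν).val : ℤ) + crd σ ν (cvec i' j' ν) + k * ((fine (R * N) M ν : ℕ) : ℤ) := by
  have hval : (((emb (R * N) M σ b i' j' ν).val : ℕ) : ℤ)
      = (((R * N : ℕ) : ℤ) * ((b ν).val : ℤ) + crd σ ν (cvec i' j' ν)) % ((fine (R * N) M ν : ℕ) : ℤ) := by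
    rw [emb_apply]; exact ZMod.val_intCast _
  refine ⟨-((((R * N : ℕ) : ℤ) * ((b ν).val : ℤ) + crd σ ν (cvec i' j' ν)) / ((fine (R * N) M ν : ℕ) : ℤ)), ?_⟩
  rw [hval, Int.emod_def]
  ring

/-- **THE CHART UNDER REFINEMENT**: the block parent of a fine chart site is the coarse chart site of the floored coordinates:
`par (emb_{RN} σ b i′ j′) = emb_N σ b ⌊i′/R⌋ ⌊j′/R⌋`. [folklore] -/
theorem par_emb (σ : Fin 2 → Bool) (b : Tor M) (i' j' : ℤ) :
    par N R M (emb (R * N) M σ b i' j') = emb N M σ b (i' / (R : ℤ)) (j' / (R : ℤ)) := by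
  have hR : (0 : ℤ) < R := by exact_mod_cast Nat.pos_of_ne_zero (NeZero.ne R)
  funext ν
  obtain ⟨k, hk⟩ := val_emb_int N R M σ b i' j' ν
  rw [emb_apply]
  unfold par
  rw [← Int.cast_natCast, Int.natCast_div, hk]
  have hcrd : crd σ ν (cvec (i' / (R : ℤ)) (j' / (R : ℤ)) ν) = crd σ ν (cvec i' j' ν) / (R : ℤ) := by
    fin_cases ν <;> simp [cvec, crd_div R]
  rw [hcrd]
  have hfine : ((fine (R * N) M ν : ℕ) : ℤ) = (R : ℤ) * ((fine N M ν : ℕ) : ℤ) := by simp only [fine]; push_cast; ring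
  rw [hfine]
  have e : ((R * N : ℕ) : ℤ) * ((b ν).val : ℤ) + crd σ ν (cvec i' j' ν) + k * ((R : ℤ) * ((fine N M ν : ℕ) : ℤ))
      = crd σ ν (cvec i' j' ν) + (R : ℤ) * ((N : ℤ) * ((b ν).val : ℤ) + k * ((fine N M ν : ℕ) : ℤ)) := by push_cast; ring
  rw [e, Int.add_mul_ediv_left _ _ hR.ne', ZMod.intCast_eq_intCast_iff, Int.modEq_iff_dvd]
  exact ⟨-k, by push_cast; ring⟩

omit [NeZero N] hM in
/-- the half-index under floor division: `R·tIdx ⌊c/R⌋ ≤ tIdx c + R`. [folklore] -/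
theorem tIdx_div_le (c : ℤ) : (R : ℤ) * tIdx (c / (R : ℤ)) ≤ tIdx c + R := by
  have hR : (0 : ℤ) < R := by exact_mod_cast Nat.pos_of_ne_zero (NeZero.ne R)
  have hq : (R : ℤ) * (c / R) = c - c % R := by rw [Int.emod_def]; ring
  have h2 := Int.emod_nonneg c hR.ne'
  have h3 := Int.emod_lt_of_pos c hR
  unfold tIdx
  by_cases hc : 0 ≤ c
  · have : 0 ≤ c / R := Int.ediv_nonneg hc hR.le
    rw [if_pos hc, if_pos this, mul_add, mul_one, hq]; linarith
  · have : ¬ 0 ≤ c / R := by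
      intro h; apply hc
      have := mul_nonneg hR.le h
      linarith
    rw [if_neg hc, if_neg this, mul_neg, hq]; linarith

omit [NeZero N] hM in
/-- **window membership under `⌊·/R⌋`**: `tIdx c ≤ R·K ⟹ tIdx ⌊c/R⌋ ≤ K`. [folklore] -/
theorem tIdx_div_le_of {c : ℤ} {K : ℕ} (h : tIdx c ≤ (R : ℤ) * K) : tIdx (c / (R : ℤ)) ≤ K := by
  have hR : (0 : ℤ) < R := by exact_mod_cast Nat.pos_of_ne_zero (NeZero.ne R)
  have hq : (R : ℤ) * (c / R) = c - c % R := by rw [Int.emod_def]; ring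
  have h2 := Int.emod_nonneg c hR.ne'
  have h3 := Int.emod_lt_of_pos c hR
  unfold tIdx at h ⊢
  by_cases hc : 0 ≤ c
  · have h0 : 0 ≤ c / R := Int.ediv_nonneg hc hR.le
    rw [if_pos hc] at h; rw [if_pos h0]
    -- `R·(c/R) ≤ c ≤ RK − 1` ⇒ `c/R ≤ K − 1`
    by_contra hlt
    have : (K : ℤ) ≤ c / R := by omega
    have := mul_le_mul_of_nonneg_left this hR.le
    linarith
  · have h0 : ¬ 0 ≤ c / R := by
      intro h'; apply hc
      have := mul_nonneg hR.le h'
      linarith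
    rw [if_neg hc] at h; rw [if_neg h0]
    -- `−c ≤ RK` ⇒ `c/R ≥ −K`
    by_contra hlt
    have : c / R ≤ -(K : ℤ) - 1 := by omega
    have := mul_le_mul_of_nonneg_left this hR.le
    linarith

omit [NeZero N] hM in
/-- the ring index under floor division: `R·ρ(⌊i/R⌋, ⌊j/R⌋) ≤ ρ(i, j) + R`. [folklore] -/
theorem rho_div_le (i j : ℤ) : (R : ℤ) * rho (i / (R : ℤ)) (j / (R : ℤ)) ≤ rho i j + R := by
  have hR : (0 : ℤ) ≤ R := by exact_mod_cast Nat.zero_le R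
  unfold rho
  rcases le_total (tIdx (i / (R : ℤ))) (tIdx (j / (R : ℤ))) with h | h
  · rw [max_eq_right h]; exact (tIdx_div_le R j).trans (by have := le_max_right (tIdx i) (tIdx j); omega)
  · rw [max_eq_left h]; exact (tIdx_div_le R i).trans (by have := le_max_left (tIdx i) (tIdx j); omega)

omit [NeZero N] hM in
/-- the ring index is 1-Lipschitz under lattice steps along the first axis. [folklore] -/
theorem rho_step_fst (i j d : ℤ) (hd : d = 1 ∨ d = -1) : rho (i + d) j ≤ rho i j + 1 := by
  obtain ⟨t1, t2, t3, t4⟩ := tIdx_step i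
  unfold rho
  rcases hd with rfl | rfl
  · exact max_le (by have := le_max_left (tIdx i) (tIdx j); omega) (by have := le_max_right (tIdx i) (tIdx j); omega)
  · rw [← sub_eq_add_neg]
    exact max_le (by have := le_max_left (tIdx i) (tIdx j); omega) (by have := le_max_right (tIdx i) (tIdx j); omega)

omit [NeZero N] hM in
/-- … and along the second axis. [folklore] -/
theorem rho_step_snd (i j d : ℤ) (hd : d = 1 ∨ d = -1) : rho i (j + d) ≤ rho i j + 1 := by
  obtain ⟨t1, t2, t3, t4⟩ := tIdx_step j
  unfold rho
  rcases hd with rfl | rfl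
  · exact max_le (by have := le_max_left (tIdx i) (tIdx j); omega) (by have := le_max_right (tIdx i) (tIdx j); omega)
  · rw [← sub_eq_add_neg]
    exact max_le (by have := le_max_left (tIdx i) (tIdx j); omega) (by have := le_max_right (tIdx i) (tIdx j); omega)

omit [NeZero N] hM in
/-- a unit step back along the first axis is the chart site `(i − (±1), j)`. [folklore] -/
theorem emb_sub_unitVec_fst (σ : Fin 2 → Bool) (b : Tor M) (i j : ℤ) :
    emb N M σ b i j - unitVec (fine N M) 0 = emb N M σ b (i + (if σ 0 then -1 else 1)) j := by
  split_ifs with h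
  · rw [← sub_eq_add_neg, emb_pred_fst, sgnVec, if_pos h]
  · rw [emb_succ_fst, sgnVec, if_neg h, sub_eq_add_neg]

omit [NeZero N] hM in
/-- … second axis. [folklore] -/
theorem emb_sub_unitVec_snd (σ : Fin 2 → Bool) (b : Tor M) (i j : ℤ) :
    emb N M σ b i j - unitVec (fine N M) 1 = emb N M σ b i (j + (if σ 1 then -1 else 1)) := by
  split_ifs with h
  · rw [← sub_eq_add_neg, emb_pred_snd, sgnVec, if_pos h]
  · rw [emb_succ_snd, sgnVec, if_neg h, sub_eq_add_neg]

/-! ## §2 The coarse weight at chart sites and the fine weight -/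

omit hM in
/-- **the coarse weight at a chart site of a family vertex is at most the distance weight**: for `(σ, b) ∈ V` and `(i, j) ∈ Q_K`,
`ω_V K (emb σ b i j) ≤ ρ(i, j)/N`. [folklore] -/
theorem omegaV_emb_le {V : Finset ((Fin 2 → Bool) × Tor M)} {σ : Fin 2 → Bool} {b : Tor M} (hv : (σ, b) ∈ V) {K : ℕ} {i j : ℤ}
    (hi : tIdx i ≤ K) (hj : tIdx j ≤ K) : omegaV N M V K (emb N M σ b i j) ≤ (rho i j : ℝ) / N := by
  have hN : (0 : ℝ) < N := by exact_mod_cast Nat.pos_of_ne_zero (NeZero.ne N)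
  have hρ : (0 : ℝ) < (rho i j : ℝ) := by exact_mod_cast (one_le_rho i j)
  have hti := one_le_tIdx i
  have htj := one_le_tIdx j
  -- the `(s, t)` term of `invW` at `(i, j)`
  obtain ⟨s, hs, rfl⟩ : ∃ s : ℕ, s < 2 * K ∧ -(K : ℤ) + s = i := ⟨(i + K).toNat, by unfold tIdx at hi; split_ifs at hi <;> omega,
    by unfold tIdx at hi; split_ifs at hi <;> omega⟩
  obtain ⟨t, ht, rfl⟩ : ∃ t : ℕ, t < 2 * K ∧ -(K : ℤ) + t = j := ⟨(j + K).toNat, by unfold tIdx at hj; split_ifs at hj <;> omega,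
    by unfold tIdx at hj; split_ifs at hj <;> omega⟩
  have hterm : (N : ℝ) / (rho (-(K : ℤ) + s) (-(K : ℤ) + t) : ℝ) ≤ invW N M (σ, b) K (emb N M σ b (-(K : ℤ) + s) (-(K : ℤ) + t)) := by
    set y := emb N M σ b (-(K : ℤ) + s) (-(K : ℤ) + t) with hy
    set g : ℕ → ℕ → ℝ := fun t' s' =>
      if y = emb N M σ b (-(K : ℤ) + s') (-(K : ℤ) + t') then (N : ℝ) / (rho (-(K : ℤ) + s') (-(K : ℤ) + t') : ℝ) else 0 with hg
    have hg0 : ∀ t' s', 0 ≤ g t' s' := by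
      intro t' s'; rw [hg]; simp only
      split_ifs
      · exact div_nonneg (Nat.cast_nonneg _) (by exact_mod_cast (le_trans zero_le_one (one_le_rho _ _)))
      · exact le_rfl
    have hgst : g t s = (N : ℝ) / (rho (-(K : ℤ) + s) (-(K : ℤ) + t) : ℝ) := by rw [hg]; simp only; rw [if_pos hy]
    change (N : ℝ) / (rho (-(K : ℤ) + s) (-(K : ℤ) + t) : ℝ) ≤ ∑ t' ∈ range (2 * K), ∑ s' ∈ range (2 * K), g t' s'
    rw [← hgst]
    calc g t s ≤ ∑ s' ∈ range (2 * K), g t s' := single_le_sum (f := fun s' => g t s') (fun s' _ => hg0 t s') (mem_range.mpr hs)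
      _ ≤ ∑ t' ∈ range (2 * K), ∑ s' ∈ range (2 * K), g t' s' :=
          single_le_sum (f := fun t' => ∑ s' ∈ range (2 * K), g t' s') (fun t' _ => sum_nonneg fun s' _ => hg0 t' s') (mem_range.mpr ht)
  have hsum : invW N M (σ, b) K (emb N M σ b (-(K : ℤ) + s) (-(K : ℤ) + t))
      ≤ ∑ v ∈ V, invW N M v K (emb N M σ b (-(K : ℤ) + s) (-(K : ℤ) + t)) :=
    single_le_sum (f := fun v => invW N M v K (emb N M σ b (-(K : ℤ) + s) (-(K : ℤ) + t))) (fun v _ => invW_nonneg N M v K _) hv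
  rw [omegaV]
  rw [inv_le_comm₀ (by linarith [sum_nonneg fun v (_ : v ∈ V) => invW_nonneg N M v K (emb N M σ b (-(K : ℤ) + s) (-(K : ℤ) + t))])
    (by positivity), inv_div]
  linarith [hterm, hsum]

/-- the FINE WEIGHT of the socket: `w′(x) = ω_V(par x) + ω_V(par x − e₀) + ω_V(par x − e₁)`. [folklore] -/
def wfine (V : Finset ((Fin 2 → Bool) × Tor M)) (K : ℕ) (x : Tor (fine (R * N) M)) : ℝ :=
  omegaV N M V K (par N R M x) + omegaV N M V K (par N R M x - unitVec (fine N M) 0)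
    + omegaV N M V K (par N R M x - unitVec (fine N M) 1)

omit [NeZero N] [NeZero R] hM in
/-- `0 ≤ w′`. [folklore] -/
theorem wfine_nonneg (V : Finset ((Fin 2 → Bool) × Tor M)) (K : ℕ) (x : Tor (fine (R * N) M)) : 0 ≤ wfine N R M V K x := by
  unfold wfine
  have h1 := omegaV_pos N M V K (par N R M x)
  have h2 := omegaV_pos N M V K (par N R M x - unitVec (fine N M) 0)
  have h3 := omegaV_pos N M V K (par N R M x - unitVec (fine N M) 1)
  linarith

omit [NeZero N] [NeZero R] hM in
/-- `w′ ≤ 3`. [folklore] -/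
theorem wfine_le_three (V : Finset ((Fin 2 → Bool) × Tor M)) (K : ℕ) (x : Tor (fine (R * N) M)) : wfine N R M V K x ≤ 3 := by
  unfold wfine
  have h1 := omegaV_le_one N M V K (par N R M x)
  have h2 := omegaV_le_one N M V K (par N R M x - unitVec (fine N M) 0)
  have h3 := omegaV_le_one N M V K (par N R M x - unitVec (fine N M) 1)
  linarith

/-- **THE FINE WEIGHT NEAR A FAMILY VERTEX IS DOMINATED BY THE FINE DISTANCE WEIGHT**: for `(σ, b) ∈ V` and a fine chart site
`x = emb_{RN} σ b i′ j′` with `tIdx i′, tIdx j′ ≤ R·(K − 1)` (`1 ≤ K`): `w′(x) ≤ 3·(ρ(i′, j′) + 2R)/(R·N)`. [folklore] -/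
theorem wfine_emb_le {V : Finset ((Fin 2 → Bool) × Tor M)} {σ : Fin 2 → Bool} {b : Tor M} (hv : (σ, b) ∈ V) {K : ℕ} (hK : 1 ≤ K)
    {i' j' : ℤ} (hi : tIdx i' ≤ (R : ℤ) * (K - 1 : ℕ)) (hj : tIdx j' ≤ (R : ℤ) * (K - 1 : ℕ)) :
    wfine N R M V K (emb (R * N) M σ b i' j') ≤ 3 * ((rho i' j' : ℝ) + 2 * R) / ((R : ℝ) * N) := by
  have hN : (0 : ℝ) < N := by exact_mod_cast Nat.pos_of_ne_zero (NeZero.ne N)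
  have hR : (0 : ℝ) < R := by exact_mod_cast Nat.pos_of_ne_zero (NeZero.ne R)
  have hRz : (0 : ℤ) ≤ R := by exact_mod_cast Nat.zero_le R
  set i := i' / (R : ℤ) with hidef
  set j := j' / (R : ℤ) with hjdef
  have hi0 : tIdx i ≤ (K - 1 : ℕ) := tIdx_div_le_of R hi
  have hj0 : tIdx j ≤ (K - 1 : ℕ) := tIdx_div_le_of R hj
  have hK1 : ((K - 1 : ℕ) : ℤ) = (K : ℤ) - 1 := by omega
  rw [hK1] at hi0 hj0
  have hρ := rho_div_le R i' j'
  rw [← hidef, ← hjdef] at hρ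
  have hρR : (rho i j : ℝ) ≤ ((rho i' j' : ℝ) + R) / R := by
    rw [le_div_iff₀ hR]; exact_mod_cast (by linarith [hρ] : (rho i j : ℤ) * R ≤ rho i' j' + R)
  obtain ⟨t1, t2, t3, t4⟩ := tIdx_step i
  obtain ⟨s1, s2, s3, s4⟩ := tIdx_step j
  unfold wfine
  rw [par_emb, emb_sub_unitVec_fst, emb_sub_unitVec_snd]
  -- the three coarse sites are chart sites in `Q_K`
  have h1 : omegaV N M V K (emb N M σ b i j) ≤ (rho i j : ℝ) / N := omegaV_emb_le N M hv (by omega) (by omega)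
  have h2 : omegaV N M V K (emb N M σ b (i + (if σ 0 then -1 else 1)) j) ≤ ((rho i j : ℝ) + 1) / N := by
    have hd : (if σ 0 then (-1 : ℤ) else 1) = 1 ∨ (if σ 0 then (-1 : ℤ) else 1) = -1 := by split_ifs <;> simp
    have hK' : tIdx (i + (if σ 0 then -1 else 1)) ≤ K := by
      split_ifs
      · rw [← sub_eq_add_neg]; omega
      · omega
    refine (omegaV_emb_le N M hv hK' (by omega)).trans ?_
    have := rho_step_fst i j _ hd
    exact div_le_div_of_nonneg_right (by exact_mod_cast this) hN.le
  have h3 : omegaV N M V K (emb N M σ b i (j + (if σ 1 then -1 else 1))) ≤ ((rho i j : ℝ) + 1) / N := by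
    have hd : (if σ 1 then (-1 : ℤ) else 1) = 1 ∨ (if σ 1 then (-1 : ℤ) else 1) = -1 := by split_ifs <;> simp
    have hK' : tIdx (j + (if σ 1 then -1 else 1)) ≤ K := by
      split_ifs
      · rw [← sub_eq_add_neg]; omega
      · omega
    refine (omegaV_emb_le N M hv (by omega) hK').trans ?_
    have := rho_step_snd i j _ hd
    exact div_le_div_of_nonneg_right (by exact_mod_cast this) hN.le
  have hsum : (rho i j : ℝ) / N + ((rho i j : ℝ) + 1) / N + ((rho i j : ℝ) + 1) / N ≤ 3 * ((rho i' j' : ℝ) + 2 * R) / ((R : ℝ) * N) := by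
    rw [← add_div, ← add_div, div_le_div_iff₀ hN (by positivity)]
    have hR1 : (1 : ℝ) ≤ R := by exact_mod_cast Nat.pos_of_ne_zero (NeZero.ne R)
    have : (rho i j : ℝ) * R ≤ (rho i' j' : ℝ) + R := by rwa [le_div_iff₀ hR] at hρR
    nlinarith
  linarith [h1, h2, h3, hsum]

/-! ## §3 The comparison hypothesis of the socket -/

/-- **`hcomp` FOR `(ω_V, w′)`**: every fine site of the `μ`-window of the coarse face at `y` has block parent `y` or `y + e_μ`, hence
`ω_V(y) ≤ w′(site)`. [folklore] -/
theorem wfine_hcomp (V : Finset ((Fin 2 → Bool) × Tor M)) (K : ℕ) :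
    ∀ (μ : Fin 2) (y : Tor (fine N M)) (j : Fin 2 → Fin R), (j μ : ℕ) = 0 → ∀ m, m < 2 * R - 2 →
      omegaV N M V K y ≤ wfine N R M V K (site N R M μ y j (m + 1)) := by
  intro μ y j hj m hm
  have h0 := omegaV_pos N M V K
  unfold wfine
  rcases Nat.lt_or_ge (m + 1) R with h | h
  · rw [par_site_lt N R M μ y hj h]
    linarith [h0 (y - unitVec (fine N M) 0), h0 (y - unitVec (fine N M) 1)]
  · rw [par_site_ge N R M μ y hj h (by omega)]
    fin_cases μ
    · simp only [Fin.zero_eta, Fin.isValue, add_sub_cancel_right]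
      linarith [h0 (y + unitVec (fine N M) 0), h0 (y + unitVec (fine N M) 0 - unitVec (fine N M) 1)]
    · simp only [Fin.mk_one, Fin.isValue, add_sub_cancel_right]
      linarith [h0 (y + unitVec (fine N M) 1), h0 (y + unitVec (fine N M) 1 - unitVec (fine N M) 0)]

end Summit.QuantumFields.BalabanUV.Beta.GAN24.DirichletVertexRefine

end
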